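import Summits.ABC.IUTFork.LDHGenuinePerImageSufficiencyRamified
import Literature.IUT.HodgeTheaters.InitialThetaDataRootsOfUnityProofs
import Literature.IUT.LogVolume.Theorem110TowerBridge
import HarnessLib

/-!
# The fork at [IUTchIII] Corollary 3.12, L-DH level, READING (P): the ramification-sharpened sufficient half at a point of
# ANY DEGREE, UNCONDITIONAL (`μ_l ⊆ K` folded in) — one closed-form real inequality in the invariants of `(λ, l)` (proof-only)

Record-only PROOF file (D-0012) of the abc-iut cell (branch C certificate seat abc-iut-C-cert-1, gen 6; row «C:ZETA-CUT»),
composing BY NAME abc-iut-c312-d1's datum-level sufficiency `Cor22.ThetaVolumeDatumAt.cor312PerImageOf_of_le_logDiff_logCond_ramified`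
(p467927) with abc-iut-s2-p4's `μ_l ⊆ K` tower form `InitialThetaData.sub_one_dvd_ramIdx_mul_ramificationIdx'` (p469827/p470694).
TAKES NO SIDE on [IUTchIII] Cor. 3.12. It generalises abc-iut-s2-p4's rational-point form `Cor22.cor312PerImageOf_ratPoint_of_le`
(p471287, `d = 1`) to a point `λ` presented over ANY number field `F_tpd` of degree `d = [F_tpd : ℚ]`:

* **`Cor22.cor312PerImageOf_of_le_degree`** — `λ ∈ U`, `l ≥ 5` prime, `d_mod ≤ (l+5)/4`; if
  `((l+1)/24 − 1/(2l))·log q^{∤2l}(λ) ≤ ((l+5)/4 − d_mod)·(log-diff(λ) + (1 − 1/l)·log 𝔣^{∤2l}(λ) + (1 − d/(l−1))·(1/d)·log l) + ((l+5)/4)·log π`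
  then `T.Cor312PerImageOf` at EVERY genuine Θ-volume datum `T` of `(λ, l)` — NO ramification hypothesis, NO named fact.

Proof: take `Sₓ = {v₀}` for one place `v₀ ∋ l` of `F_tpd` (`𝓞_{F_tpd}` is integral over `ℤ`), so `N(v₀) = l^{f} ≥ l` and `v₀ ∉ 𝕍^bad_mod`
(bad places are taken away from `2l`); for every place `w` of `K` over `v₀`, `(l − 1) ∣ e(v₀ | l)·e(w | v₀)` (`ζ_l ∈ K = F(E_F[l])` by the
Weil pairing, `l` totally ramified in `ℚ(ζ_l)`) and `e(v₀ | l) ≤ d`, whence `e(w | v₀) ≥ m` for the least `m` with `l − 1 ≤ d·m`, and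
`1 − 1/m ≥ 1 − d/(l−1)`. For `d ≥ l − 1` the extra term is `≤ 0` and the statement is weaker than the plain one; for `d = 1` it is
abc-iut-s2-p4's. CONSUMER: the ζ-CUT certificates `Conditional/AbcOfSlotLicenceGenuineKZeta.lean` (the Szpiro-bad (P)/joint binders
assumed ONLY where this sufficiency fails).

HONEST SCOPE. A statement about the cell's typed objects: at such `(λ, l)` the per-image number-level Corollary in READING (P), AS TYPED,
holds at every genuine datum; nothing asserts that data exist there, nothing asserts Cor. 3.12 in general or in print's reading, nothing
asserts abc. proved-as-typed ≠ in print. [cite: Mochizuki2012, IUTchI Def. 3.1 (c) p. 62; IUTchIII Cor. 3.12 p. 173–174; IUTchIV Thm. 1.10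
Step (ii) p. 24, Step (v) p. 27–29] [cite: MochizukiGenEll2010, Prop. 1.7 (i) p. 9–10] [cite: SilvermanAEC2009, Cor. III.8.1.1]
[cite: Washington1997, Lemma 1.4 and Prop. 2.1] [claim: Mochizuki2012, status: disputed] for every IUT quotation. PROOF-ONLY: no definitions,
no new `Prop`.
-/

noncomputable section

namespace Literature.IUT.LogVolume.Cor22

open NumberField IsDedekindDomain Ideal Module Literature.NumberTheory.DiophantineGeometry
open Literature.NumberTheory.DiophantineGeometry.GenEll Summit.ABC.IUTFork Literature.IUT.HodgeTheaters

/-- **ANY DEGREE, UNCONDITIONAL FORM of the ramification-sharpened per-image sufficiency.** For a point `λ ∈ U` presented over a number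
field `F_tpd` of degree `d`, a prime `l ≥ 5` with `d_mod ≤ (l+5)/4`: if
`((l+1)/24 − 1/(2l))·log q^{∤2l}(λ) ≤ ((l+5)/4 − d_mod)·(log-diff(λ) + (1 − 1/l)·log 𝔣^{∤2l}(λ) + (1 − d/(l−1))·(1/d)·log l) + ((l+5)/4)·log π`
then `T.Cor312PerImageOf` ([IUTchIII] Cor. 3.12 in the cell's READING (P), as typed) holds at EVERY genuine Θ-volume datum `T` of `(λ, l)`:
abc-iut-c312-d1's `cor312PerImageOf_of_le_logDiff_logCond_ramified` at `Sₓ = {v₀}` (`v₀ ∋ l` a place of `F_tpd`, `N(v₀) ≥ l`) with `m` the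
least integer `≥ (l−1)/d`, the ramification hypothesis being a THEOREM for genuine data (`μ_l ⊆ K`: abc-iut-s2-p4's
`InitialThetaData.sub_one_dvd_ramIdx_mul_ramificationIdx'`, and `e(v₀ | l) ≤ d`). At `d = 1` this is `cor312PerImageOf_ratPoint_of_le`'s test.
[cite: Mochizuki2012, IUTchIII Cor. 3.12 p. 173–174] [cite: Mochizuki2012, IUTchIV Thm. 1.10 Step (ii) p. 24, Step (v) p. 27–29]
[cite: SilvermanAEC2009, Cor. III.8.1.1] [cite: Washington1997, Lemma 1.4 and Prop. 2.1] [claim: Mochizuki2012, status: disputed] -/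
theorem cor312PerImageOf_of_le_degree {P : NFPoint} {l : ℕ} (hU : P.InU) (hl : l.Prime) (h5 : 5 ≤ l)
    (hd : (dmod P : ℝ) ≤ ((l : ℝ) + 5) / 4)
    (h : (((l : ℝ) + 1) / 24 - 1 / (2 * l)) * logQAvoid P {2, l} ≤
      (((l : ℝ) + 5) / 4 - dmod P) * (P.logDiff + (1 - 1 / (l : ℝ)) * logCondAvoid P {2, l}
          + (1 - (P.degree : ℝ) / ((l : ℝ) - 1)) * ((P.degree : ℝ)⁻¹ * Real.log l))
        + ((l : ℝ) + 5) / 4 * Real.log Real.pi)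
    (T : ThetaVolumeDatumAt P l) : T.Cor312PerImageOf := by
  classical
  letI := T.instFieldF; letI := T.instNumberFieldF; letI := T.instAlgebraF; letI := T.instFieldK
  letI := T.instNumberFieldK; letI := T.instAlgebraK; letI := T.instFieldFbar; letI := T.instAlgebraFbar
  letI := T.instAlgebraKFbar; letI := T.instIsElliptic
  letI : Algebra P.F T.K := ((algebraMap T.F T.K).comp (algebraMap P.F T.F)).toAlgebra
  -- a place `v₀` of `F_tpd` over `l`
  haveI : Fact l.Prime := ⟨hl⟩
  obtain ⟨⟨Q, hQ, hQo⟩⟩ := Ideal.nonempty_primesOver (S := 𝓞 P.F) (Ideal.span {(l : ℤ)})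
  have hQ0 : Q ≠ ⊥ :=
    Ideal.ne_bot_of_liesOver_of_ne_bot (by simp [hl.ne_zero] : Ideal.span {(l : ℤ)} ≠ ⊥) Q
  let v₀ : HeightOneSpectrum (𝓞 P.F) := ⟨Q, hQ, hQ0⟩
  have hmem : ((l : ℕ) : 𝓞 P.F) ∈ v₀.asIdeal := by
    have h1 : ((l : ℕ) : ℤ) ∈ Q.under ℤ := hQo.over ▸ Ideal.mem_span_singleton_self (l : ℤ)
    have h2 := Ideal.mem_comap.mp h1
    rwa [map_natCast] at h2
  -- `v₀ ∉ 𝕍^bad_mod` (bad places are taken away from `2l`)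
  have hnot : v₀ ∉ badPlacesAvoid P {2, l} := by
    intro hbad
    unfold badPlacesAvoid at hbad
    exact (Finset.mem_filter.1 hbad).2 l (Finset.mem_insert_of_mem (Finset.mem_singleton_self l)) hmem
  -- `d = [F_tpd : ℚ]`, and the least `m` with `l - 1 ≤ d·m`
  have hd0 : 0 < P.degree := P.degree_pos
  have hex : ∃ m : ℕ, l - 1 ≤ P.degree * m := ⟨l - 1, Nat.le_mul_of_pos_left _ hd0⟩
  have hdm : l - 1 ≤ P.degree * Nat.find hex := Nat.find_spec hex
  have hm0 : 0 < Nat.find hex := by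
    rcases Nat.eq_zero_or_pos (Nat.find hex) with h0 | h0
    · rw [h0, mul_zero] at hdm; omega
    · exact h0
  -- `e(v₀ | l) ≤ d`
  have he1 : ramIdx P.F v₀ ≤ P.degree := by
    haveI : v₀.asIdeal.IsMaximal := v₀.isMaximal
    haveI : (v₀.asIdeal.under ℤ).IsMaximal := Ideal.IsMaximal.under ℤ v₀.asIdeal
    have h0 : v₀.asIdeal.under ℤ ≠ ⊥ := mt Ideal.eq_bot_of_comap_eq_bot v₀.ne_bot
    have hle : v₀.asIdeal.ramificationIdx ℤ ≤ Module.finrank ℚ P.F := by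
      rw [← Ideal.ramificationIdx'_eq_ramificationIdx (v₀.asIdeal.under ℤ) v₀.asIdeal h0]
      exact Ideal.ramificationIdx_le_finrank (𝓞 P.F) ℚ P.F v₀.asIdeal (p := v₀.asIdeal.under ℤ)
    rw [← ramIdx_eq] at hle
    exact hle
  -- the ramification hypothesis over `Sₓ = {v₀}` with this `m` HOLDS (μ_l ⊆ K)
  have hram : ∀ v ∈ ({v₀} : Finset (HeightOneSpectrum (𝓞 P.F))),
      ∀ w ∈ IsDedekindDomain.primesOverFinset v.asIdeal (𝓞 T.K), Nat.find hex ≤ ramificationIdx' v.asIdeal w := by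
    intro v hv w hw
    rw [Finset.mem_singleton] at hv
    rw [hv] at hw ⊢
    have hdvd := T.D.sub_one_dvd_ramIdx_mul_ramificationIdx' v₀ hmem hw
    haveI : v₀.asIdeal.IsMaximal := v₀.isMaximal
    have hw' := (IsDedekindDomain.mem_primesOverFinset_iff v₀.ne_bot (𝓞 T.K)).mp hw
    haveI : w.IsPrime := hw'.1
    haveI : w.LiesOver v₀.asIdeal := hw'.2
    have he2 : 0 < ramificationIdx' v₀.asIdeal w :=
      Nat.pos_of_ne_zero (Ideal.IsDedekindDomain.ramificationIdx'_ne_zero_of_liesOver w v₀.ne_bot)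
    have hprod : 0 < ramIdx P.F v₀ * ramificationIdx' v₀.asIdeal w :=
      Nat.mul_pos (Nat.pos_of_ne_zero (ramIdx_ne_zero P.F v₀)) he2
    have hle : l - 1 ≤ ramIdx P.F v₀ * ramificationIdx' v₀.asIdeal w := Nat.le_of_dvd hprod hdvd
    have hle' : l - 1 ≤ P.degree * ramificationIdx' v₀.asIdeal w :=
      hle.trans (Nat.mul_le_mul_right _ he1)
    exact Nat.find_min' hex hle'
  -- `log l ≤ log N(v₀)`
  have hres : residueChar P.F v₀ = l := (natCast_mem_asIdeal_iff_residueChar_eq v₀ hl).1 hmem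
  have hN : Ideal.absNorm v₀.asIdeal = l ^ resDeg P.F v₀ := by rw [absNorm_eq, hres]
  have hlN : (l : ℝ) ≤ ((Ideal.absNorm v₀.asIdeal : ℕ) : ℝ) := by
    rw [hN]; push_cast
    exact le_self_pow₀ (by exact_mod_cast hl.one_lt.le) (resDeg_ne_zero P.F v₀)
  have hnorm : Real.log l ≤ Real.log ((Ideal.absNorm v₀.asIdeal : ℕ) : ℝ) :=
    Real.log_le_log (by exact_mod_cast hl.pos) hlN
  refine T.cor312PerImageOf_of_le_logDiff_logCond_ramified hU hl.pos hd {v₀}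
    (Finset.disjoint_singleton_right.2 hnot) hm0 hram ?_
  have harch : ThetaVolumeInput.archLogTheta l = ((l : ℝ) + 5) / 4 * Real.log Real.pi := rfl
  rw [harch, Finset.sum_singleton]
  -- the real bookkeeping: `(1 − d/(l−1))·(1/d)·log l ≤ (1 − 1/m)·(1/d)·log N(v₀)`
  have hC : 0 ≤ ((l : ℝ) + 5) / 4 - (dmod P : ℝ) := by linarith
  have hdR : (0 : ℝ) < (P.degree : ℝ) := by exact_mod_cast hd0
  have hlogl : 0 ≤ Real.log l := Real.log_nonneg (by exact_mod_cast hl.one_lt.le)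
  have hX : 0 ≤ (P.degree : ℝ)⁻¹ * Real.log l := mul_nonneg (inv_nonneg.2 hdR.le) hlogl
  have hXY : (P.degree : ℝ)⁻¹ * Real.log l ≤ (P.degree : ℝ)⁻¹ * Real.log ((Ideal.absNorm v₀.asIdeal : ℕ) : ℝ) :=
    mul_le_mul_of_nonneg_left hnorm (inv_nonneg.2 hdR.le)
  have hmR : (0 : ℝ) < (Nat.find hex : ℝ) := by exact_mod_cast hm0
  have hl1 : (0 : ℝ) < (l : ℝ) - 1 := by
    have : (5 : ℝ) ≤ (l : ℝ) := by exact_mod_cast h5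
    linarith
  have hdmR : (l : ℝ) - 1 ≤ (P.degree : ℝ) * (Nat.find hex : ℝ) := by
    have h1 : ((l - 1 : ℕ) : ℝ) = (l : ℝ) - 1 := by
      rw [Nat.cast_sub hl.one_lt.le]; push_cast; ring
    rw [← h1]; exact_mod_cast hdm
  have hfac : (1 - (P.degree : ℝ) / ((l : ℝ) - 1)) ≤ 1 - (Nat.find hex : ℝ)⁻¹ := by
    have hinv : (Nat.find hex : ℝ)⁻¹ ≤ (P.degree : ℝ) / ((l : ℝ) - 1) := by
      rw [le_div_iff₀ hl1]
      calc (Nat.find hex : ℝ)⁻¹ * ((l : ℝ) - 1)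
          ≤ (Nat.find hex : ℝ)⁻¹ * ((P.degree : ℝ) * (Nat.find hex : ℝ)) :=
            mul_le_mul_of_nonneg_left hdmR (inv_nonneg.2 hmR.le)
        _ = (P.degree : ℝ) := by
            rw [mul_comm (P.degree : ℝ), ← mul_assoc, inv_mul_cancel₀ hmR.ne', one_mul]
    linarith
  have hfac0 : 0 ≤ 1 - (Nat.find hex : ℝ)⁻¹ := by
    have : (Nat.find hex : ℝ)⁻¹ ≤ 1 := inv_le_one_of_one_le₀ (by exact_mod_cast hm0)
    linarith
  have key : (1 - (P.degree : ℝ) / ((l : ℝ) - 1)) * ((P.degree : ℝ)⁻¹ * Real.log l) ≤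
      (1 - (Nat.find hex : ℝ)⁻¹) * ((P.degree : ℝ)⁻¹ * Real.log ((Ideal.absNorm v₀.asIdeal : ℕ) : ℝ)) :=
    (mul_le_mul_of_nonneg_right hfac hX).trans (mul_le_mul_of_nonneg_left hXY hfac0)
  have key' := mul_le_mul_of_nonneg_left
    (add_le_add_left key (P.logDiff + (1 - 1 / (l : ℝ)) * logCondAvoid P {2, l})) hC
  linarith

/-- **AT EVERY DATUM** (the `∀ T` form consumed by the certificates): under the hypotheses of `cor312PerImageOf_of_le_degree`,
`T.Cor312PerImageOf` for every genuine Θ-volume datum `T` of `(λ, l)`. [cite: Mochizuki2012, IUTchIII Cor. 3.12 p. 173–174]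
[claim: Mochizuki2012, status: disputed] -/
theorem cor312PerImageOf_of_le_degree_all {P : NFPoint} {l : ℕ} (hU : P.InU) (hl : l.Prime) (h5 : 5 ≤ l)
    (hd : (dmod P : ℝ) ≤ ((l : ℝ) + 5) / 4)
    (h : (((l : ℝ) + 1) / 24 - 1 / (2 * l)) * logQAvoid P {2, l} ≤
      (((l : ℝ) + 5) / 4 - dmod P) * (P.logDiff + (1 - 1 / (l : ℝ)) * logCondAvoid P {2, l}
          + (1 - (P.degree : ℝ) / ((l : ℝ) - 1)) * ((P.degree : ℝ)⁻¹ * Real.log l))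
        + ((l : ℝ) + 5) / 4 * Real.log Real.pi) :
    ∀ T : ThetaVolumeDatumAt P l, T.Cor312PerImageOf :=
  fun T => cor312PerImageOf_of_le_degree hU hl h5 hd h T

end Literature.IUT.LogVolume.Cor22

end
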